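import Summits.BirchSwinnertonDyer.BirchSwinnertonDyer.Theorems.CMKolyvaginAtInertTwoInertOrderSplittingSelmer
import Summits.BirchSwinnertonDyer.BirchSwinnertonDyer.Theorems.CMKolyvaginAtInertTwoRestrictionInjectiveAtTwo
import HarnessLib

/-!
# Route `CMKolyvaginAtInertTwo`, crux `CMKolyvaginExactAtInertTwo` (stmt-BirchSwinnertonDyer-24277):
# the exact Selmer splitting over the TOWER `ℚ ⊂ K ⊂ L` of the Morita frame (`K` imaginary quadratic,
# `L/K` quadratic and normal over `ℚ` containing `√d_F`, e.g. `L = K·F`): the `3`-cycle and the lift of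
# complex conjugation are DISCHARGED, leaving the local-points-maps input of stub S1

Seat `bsd-line-cmk2-p1` g10 (cell `bsd-print-cf2`); helper (`--supports stmt-BirchSwinnertonDyer-24277`).
THEOREMS ONLY: no definition, no named fact, no `sorry`; no item is closed; BSD is not proved by this.
Memo `Cruxes/CMExactDescentAtTwo/MEMO-inert-order-splitting.md` §§3–5.

* `exists_fixedPointFree_two_of_tower` — on `H₂` (`ρ̄_{E,2}` onto), for `K` quadratic and `[L : K] = 2`:
  some `z ∈ Γ_L` acts on `E_L[2]` without non-zero fixed point (g3's `3`-cycle over `K`, squared;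
  `(E_K)_L = E_L` by `baseChange_baseChange_eq`).
* `restrictNormal_transport_mul_self` — the restriction `σ` to a normal `L` of the transported complex
  conjugation is an involution.
* `natCard_selmer_eq_sq_of_tower` — **`#Sel_{2^M}(E_L/L) = (#Sel_{2^M}(E_L/L)^{σ})²`** for every `M`, for
  `E ∈ H₂` (`HasCM ∧ CMInert W 2 ∧ ρ̄₂` onto), `K` imaginary quadratic, `L ⊇ K` quadratic over `K`, normal
  over `ℚ`, totally complex, `√d_F ∈ L`, `σ =` complex conjugation of `L`; GRANTED only that the
  equivariant CM generators on `E_L(L̄)` have local points maps (ShaIsogeny's `HasLocalPointsMaps`, the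
  residue of stub S1 — an instance of the named fact `Isogeny.hasLocalPointsMaps` once `η` is packaged).

References: Lang, *Elliptic Functions*, Ch. 10 §4 [Lang1987]; Gross 1991 §9 [GrossLMS1991]; Milne *ADT*
I.§7 [MilneADT2006].
-/

-- single-conjunct summit: `Summit.BirchSwinnertonDyer.BirchSwinnertonDyer.…` repeats the name by design
set_option linter.dupNamespace false
set_option autoImplicit false

noncomputable section

open scoped Classical

namespace Summit.BirchSwinnertonDyer.BirchSwinnertonDyer.Theorems.InertOrderSplittingHabitat

open WeierstrassCurve Field NumberField
open Literature.NumberTheory.EllipticCurves Literature.NumberTheory.EllipticCurves.Rank1Residual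
open Literature.NumberTheory.GaloisRepresentations
open Summit.BirchSwinnertonDyer.BirchSwinnertonDyer.Theorems.KolyvaginImageTwo

variable (W : WeierstrassCurve ℚ) [W.IsElliptic]

/-- **A `3`-cycle on `E_L[2]` in `Γ_L` over the tower `ℚ ⊂ K ⊂ L`** (`[K:ℚ] = 2`, `[L:K] = 2`, `ρ̄_{E,2}`
onto): g3's order-`3` element over `K` squared lies in `Γ_L` and acts without non-zero fixed point.
[cite: GrossLMS1991, §9 (before Prop. 9.1)] -/
theorem exists_fixedPointFree_two_of_tower (K : Type) [Field K] [NumberField K]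
    (hK2 : Module.finrank ℚ K = 2) (hsurj : W.HasSurjectiveModNGaloisRep 2)
    (L : Type) [Field L] [NumberField L] [Algebra K L] (hL : Module.finrank K L = 2) :
    ∃ z : absoluteGaloisGroup L,
      ∀ P : geomPoints (W.baseChange L), (2 : ℤ) • P = 0 → z • P = P → P = 0 := by
  haveI : (W.baseChange K).IsElliptic := by rw [baseChange]; infer_instance
  obtain ⟨z, hz3, hz⟩ := exists_smul_three_of_hasSurjectiveModNGaloisRep W K hK2 hsurj
  have mem : ∀ {P : geomPoints (W.baseChange K)}, (2 : ℤ) • P = 0 →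
      P ∈ geomTorsion (W.baseChange K) ((2 : ℕ) : ℤ) := fun h ↦ by
    rw [mem_geomTorsion_iff]; exact_mod_cast h
  have hz3' : ∀ P : geomPoints (W.baseChange K), (2 : ℤ) • P = 0 → z • z • z • P = P := fun P h ↦ by
    have h3 := congrArg Subtype.val (hz3 ⟨P, mem h⟩)
    simpa only [AddSubgroup.torsionBy.coe_smul] using h3
  have hz' : ∀ P : geomPoints (W.baseChange K), (2 : ℤ) • P = 0 → z • P = P → P = 0 := fun P h hfix ↦
    congrArg Subtype.val (hz ⟨P, mem h⟩ (Subtype.ext (by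
      rw [AddSubgroup.torsionBy.coe_smul]; exact hfix)))
  haveI : FiniteDimensional K L := Module.finite_of_finrank_eq_succ hL
  obtain ⟨g, hg⟩ := exists_fixedPointFree_two_of_finrank_eq_two (W.baseChange K) L hL hz3' hz'
  rw [baseChange_baseChange_eq W L] at hg
  exact ⟨g, hg⟩

variable {L : Type} [Field L] [NumberField L] {c₀ : absoluteGaloisGroup ℚ}

/-- The restriction to a normal `L` of the transported complex conjugation is an involution. [folklore] -/
theorem restrictNormal_transport_mul_self [Normal ℚ L] (hc₀ : IsComplexConjugation (Rat.castHom ℝ) c₀) :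
    (absGaloisTransport (K := ℚ) (L := L) c₀).restrictNormal L *
      (absGaloisTransport (K := ℚ) (L := L) c₀).restrictNormal L = 1 := by
  change AlgEquiv.restrictNormalHom L (absGaloisTransport (K := ℚ) (L := L) c₀) *
    AlgEquiv.restrictNormalHom L (absGaloisTransport (K := ℚ) (L := L) c₀) = 1
  rw [← map_mul, ← map_mul, ← pow_two, hc₀.sq_eq_one, map_one, map_one]

/-- **THE EXACT SELMER SPLITTING OVER THE TOWER** (Morita frame, memo §3): for `E ∈ H₂` (CM, `2` inert in
`F`, `ρ̄_{E,2}` onto), `K` imaginary quadratic, `L ⊇ K` with `[L:K] = 2`, normal over `ℚ`, totally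
complex, containing `√d_F`, and `σ` the restriction to `L` of (the transport of) a complex conjugation
`c₀`: **`#Sel_{2^M}(E_L/L) = (#Sel_{2^M}(E_L/L)^{σ})²` for every `M`**, granted that every
`Γ_L`-equivariant endomorphism `η` of `E_L(L̄)` with `η² + mη = c` has local points maps (stub S1's
residue). [cite: Lang1987, Ch. 10 §4, Remark] [cite: MilneADT2006, I.§7] -/
theorem natCard_selmer_eq_sq_of_tower [Normal ℚ L] (hCM : W.HasCM) (hin : CMInert W 2)
    (hsurj : W.HasSurjectiveModNGaloisRep 2) (K : Type) [Field K] [NumberField K]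
    (hK : IsImaginaryQuadratic K) [Algebra K L] (hLK : Module.finrank K L = 2)
    (hLc : ∀ w : InfinitePlace L, w.IsComplex) (hF : IsSquare (algebraMap ℚ L (cmFieldDiscrOfJ W.j)))
    (hc₀ : IsComplexConjugation (Rat.castHom ℝ) c₀)
    (hloc : ∀ (η : AddMonoid.End (geomPoints (W.baseChange L))) (m c : ℤ),
      (∀ P, η (η P) + m • η P = c • P) →
      (∀ (γ : absoluteGaloisGroup L) (P : geomPoints (W.baseChange L)), γ • η P = η (γ • P)) →
        HasLocalPointsMaps (W.baseChange L) (W.baseChange L) η)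
    (M : ℕ) :
    Nat.card (selmerGroup (W.baseChange L) ((2 : ℤ) ^ M)) =
      Nat.card {x : selmerGroup (W.baseChange L) ((2 : ℤ) ^ M) //
        conjAct W ((absGaloisTransport (K := ℚ) (L := L) c₀).restrictNormal L) _
          (x : galH1Torsion (W.baseChange L) ((2 : ℤ) ^ M)) = x} ^ 2 := by
  obtain ⟨z, hz⟩ := exists_fixedPointFree_two_of_tower W K hK.1 hsurj L hLK
  exact natCard_selmer_eq_sq_of_hasLocalPointsMaps W hCM hin hsurj hLc hF hc₀
    (restrictNormal_transport_mul_self hc₀) (RatClosure.isLiftOfAut_restrictNormal_absGaloisTransport c₀)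
    hz hloc M

end Summit.BirchSwinnertonDyer.BirchSwinnertonDyer.Theorems.InertOrderSplittingHabitat
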